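import Literature.NumberTheory.Automorphic.PiOfArtinRepAtSigmaUnramifiedPlacesHeckeTheoryProofs
import Literature.NumberTheory.GaloisRepresentations.HeckeCharacterGaloisAvatarProofs
import HarnessLib

/-!
# Gelbart's Prop. 4.1 (both unramified shadows): the auxiliary characters from Hecke
characters, via the tree's class field theory (pure proofs; companion to
`Automorphic/PiOfArtinRepAtSigmaUnramifiedPlacesHeckeTheoryProofs`)

`frobSatakeCompatibleAt_of_isPiOfArtinRep_both_of_heckeTheory` displays two hypotheses: `HT`
(the twisted Hecke theory of cuspidal `GL(2)`, Jacquet–Langlands 1970) and `Hχ` — the existence,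
for a finite place `v`, a finite set `S ∌ v` of finite places and `N`, of a continuous character
`χ : Γ_F → ℂˣ` trivial on the inertia groups and the Frobenius elements above `v` and such that
every inertia group above every `w ∈ S` contains `g` with `χ(g)^k ≠ 1` for `0 < k ≤ N`.  This
file **proves the Galois half of `Hχ`** from the tree's (complete) global class field theory for
finite-order Hecke characters (`HeckeCharacter.exists_framedArtinRep_of_isFiniteOrder`: every
finite-order Hecke character `η` is the Hecke character of a rank-one Artin representation `ψ_η`,
unramified exactly where `η` is, with `ψ_η(Φ) = η(ϖ_u)` at those places — Tate, Cassels–Fröhlich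
VII §5.1; Neukirch VI (6.6), VII (10.6)), leaving as displayed hypothesis only the idelic
statement

* `Hη` — for `v`, `S ∌ v` finite and `N` there is a Hecke character `η` of `F` of finite order,
  unramified at `v` with `η(ϖ_v) = 1` (i.e. trivial on `F_v^×`), such that `η^k` is ramified at
  every `w ∈ S` for all `0 < k ≤ N` (i.e. `η|_{𝒪_w^×}` has order `> N`).  This is Jacquet–Langlands
  1970, Lemma 12.5 ("there is a quasi-character of `F^× \ 𝔸^×` trivial on `F_v^×` and highly
  ramified at the places of `S`") in the *order* form; proof: characters of
  `𝒪_w^×/(1 + 𝔭_w^m)` of large order extend to a finite-order character of the idèle class group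
  trivial on `F_v^×` as soon as `∏_{w ∈ S} 𝒪_w^×/(1 + 𝔭_w^m)` injects into a generalised class
  group `𝔸^×/F^×U` with `U ⊇ F_v^×` of level divisible by auxiliary primes, which is Chevalley's
  congruence subgroup theorem for the finitely generated group of `{v}`-units (*Deux théorèmes
  d'arithmétique*, J. Math. Soc. Japan 3 (1951), Thm. 1) — not in the tree.

Contents:

* `FramedArtinRep.det_apply_eq_of_hasFrobCharpolyAt` — for `ψ : Γ_F → GL_1(ℂ)` with
  `ψ.HasFrobCharpolyAt v (X - a)`, `det ψ(Φ) = a` at every arithmetic Frobenius `Φ` above `v`.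
* `FramedArtinRep.det_eq_pow_of_avatar` — **the Artin avatar of `η^k` is the `k`-th power of
  that of `η`**: if `ψ`, `ψ_k` are the rank-one Artin representations of `η`, `η^k` (in the sense
  of `exists_framedArtinRep_of_isFiniteOrder`), then `det ψ_k = (det ψ)^k` — both are continuous
  and agree at the Frobenius elements off the finitely many ramified places of `ψ` and `ψ_k`
  (`(η^k)(ϖ_u) = η(ϖ_u)^k`), so Frobenius density
  (`absoluteGaloisGroup.monoidHom_eq_of_frobenius'`) applies.
* `exists_galoisCharacter_of_heckeCharacter` — **`Hη ⟹ Hχ` pointwise**: `χ := det ψ_η` is trivial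
  on inertia above `v` (`ψ_η` unramified there) and on the Frobenius elements above `v`
  (`ψ_η(Φ) = η(ϖ_v) = 1`); and for `w ∈ S`, `𝔓 ∣ w`: the image `χ(I_𝔓)` is a finite subgroup of
  `ℂˣ`, hence cyclic (Mathlib `subgroup_units_cyclic`), generated by some `χ(g₀)`, `g₀ ∈ I_𝔓`; if
  `χ(g₀)^k = 1` with `0 < k ≤ N` then `χ^k` kills `I_𝔓`, hence (conjugating, `I_{τ𝔓} = τ I_𝔓 τ⁻¹`)
  every inertia group above `w`, so `det ψ_{η^k} = χ^k` kills them, `ψ_{η^k}` is unramified at `w`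
  (a `1 × 1` matrix is its determinant) and so is `η^k` — contradicting `Hη`.
* `frobSatakeCompatibleAt_of_isPiOfArtinRep_both_of_heckeCharacters` — **both named facts
  `frobSatakeCompatibleAt_of_isPiOfArtinRep` and
  `frobSatakeCompatibleAt_of_isPiOfArtinRep_of_isUnramifiedAt` (Gelbart 1997, Prop. 4.1) from
  `Hη` and `HT`**, i.e. from Jacquet–Langlands 1970, Lemma 12.5 (order form) and Thm. 11.1,
  Cor. 11.2, Thm. 2.18, Props. 3.5, 3.6, 3.8 (with the unramified dictionary), everything else —
  the reciprocity step, all Galois-side local computations, the converse-theorem-free comparison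
  of Euler products and the rigidity `B = A` — being proved in the tree.

No definition and no named fact is introduced (D-0026).

## References

* H. Jacquet, R. P. Langlands, *Automorphic Forms on GL(2)*, LNM 114 (1970), Lemma 12.5 and
  proof of Thm. 12.2 (p. 210). [JacquetLanglands1970]
* C. Chevalley, *Deux théorèmes d'arithmétique*, J. Math. Soc. Japan 3 (1951), 36–44, Thm. 1.
* J. Tate, *Global class field theory*, Ch. VII of Cassels–Fröhlich (1967), §5.1.
  [CasselsFrohlichANT1967]
* J. Neukirch, *Algebraic Number Theory* (1999), Ch. I §9 (9.4); VI (6.6); VII (10.6).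
  [NeukirchANT1999]
* S. Gelbart, *Three lectures on the modularity of `ρ̄_{E,3}` and the Langlands reciprocity
  conjecture* (1997), Prop. 4.1. [Gelbart1997]
-/

noncomputable section

open scoped MatrixGroups NumberField Polynomial Matrix Pointwise
open NumberField IsDedekindDomain Field Polynomial Complex Filter Topology Set
open Literature.NumberTheory.GaloisRepresentations (ArtinRep FramedArtinRep absIntegers
  HeckeCharacter)
open Literature.NumberTheory.LFunctions

namespace Literature.NumberTheory.Automorphic

section AuxiliaryCharacters

variable {F : Type} [Field F] [NumberField F]

omit [NumberField F] in
/-- `I_{τ • 𝔓} = τ I_𝔓 τ⁻¹`: if `g ∈ I_{τ • 𝔓}` then `τ⁻¹ g τ ∈ I_𝔓` (Neukirch I §9 (9.4); the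
tree's `DegreeOnePrimesFixedField.conj_mem_inertia_of_mem_inertia_smul`, restated privately to keep
the imports small). [folklore] -/
private theorem conj_mem_inertia_of_mem_inertia_smul' {𝔓 : Ideal (absIntegers (𝓞 F) F)}
    {τ g : absoluteGaloisGroup F} (hg : g ∈ (τ • 𝔓).inertia (absoluteGaloisGroup F)) :
    τ⁻¹ * g * τ ∈ 𝔓.inertia (absoluteGaloisGroup F) := by
  intro x
  have hx : g • τ • x - τ • x ∈ τ • 𝔓 := hg (τ • x)
  rw [Ideal.mem_pointwise_smul_iff_inv_smul_mem, smul_sub] at hx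
  simpa [mul_smul] using hx

omit [NumberField F] in
/-- For `ψ : Γ_F → GL_1(ℂ)`, `det ψ(g) = ψ(g)₀₀` (a `1 × 1` matrix is its entry). [folklore] -/
private theorem coe_det_apply_of_rank_one' (ψ : FramedArtinRep F 1) (g : absoluteGaloisGroup F) :
    ((GaloisRepresentations.FramedRep.det ψ g : ℂˣ) : ℂ) =
      ((ψ g : GL (Fin 1) ℂ) : Matrix (Fin 1) (Fin 1) ℂ) 0 0 := by
  rw [GaloisRepresentations.FramedRep.det_apply, Matrix.GeneralLinearGroup.val_det_apply,
    Matrix.det_fin_one]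

omit [NumberField F] in
/-- For `ψ : Γ_F → GL_1(ℂ)`, `det ψ(g) = 1 ⟹ ψ(g) = 1`
(`generalLinearGroup_fin_one_eq_of_det_eq`). [folklore] -/
private theorem apply_eq_one_of_det_eq_one' (ψ : FramedArtinRep F 1) {g : absoluteGaloisGroup F}
    (h : GaloisRepresentations.FramedRep.det ψ g = 1) : ψ g = 1 :=
  GaloisRepresentations.generalLinearGroup_fin_one_eq_of_det_eq (by
    rw [GaloisRepresentations.FramedRep.det_apply] at h
    rw [h, map_one])

/-- `(η^k)(ϖ_v) = η(ϖ_v)^k` (the tree's `HeckeCharacter.valueAtUniformizer_pow` of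
`PairLFunctionBaseChangeAutomorphic`, restated privately to keep the imports small). [folklore] -/
private theorem valueAtUniformizer_pow'
    (η : HeckeCharacter F) (k : ℕ) (v : HeightOneSpectrum (𝓞 F)) :
    (η ^ k).valueAtUniformizer v = η.valueAtUniformizer v ^ k := by
  rw [HeckeCharacter.valueAtUniformizer, HeckeCharacter.valueAtUniformizer,
    HeckeCharacter.localComponent_apply, HeckeCharacter.localComponent_apply,
    HeckeCharacter.pow_apply, Units.val_pow_eq_pow_val]

/-- **The Frobenius value of a rank-one Artin representation**: if
`ψ.HasFrobCharpolyAt v (X - a)` then `det ψ(Φ) = a` for every arithmetic Frobenius `Φ` at every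
prime above `v` (`FramedGaloisRep.hasFrobCharpolyAt_iff_of_rank_one`). [folklore] -/
theorem FramedArtinRep.det_apply_eq_of_hasFrobCharpolyAt (ψ : FramedArtinRep F 1)
    {v : HeightOneSpectrum (𝓞 F)} {a : ℂ} (h : ψ.HasFrobCharpolyAt v (X - C a))
    {𝔓 : Ideal (absIntegers (𝓞 F) F)} (h𝔓 : 𝔓 ∈ v.primesAbove) {Φ : absoluteGaloisGroup F}
    (hΦ : IsArithFrobAt (𝓞 F) Φ 𝔓) :
    ((GaloisRepresentations.FramedRep.det ψ Φ : ℂˣ) : ℂ) = a := by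
  rw [coe_det_apply_of_rank_one']
  exact (GaloisRepresentations.FramedGaloisRep.hasFrobCharpolyAt_iff_of_rank_one ψ v a).mp h 𝔓 h𝔓
    Φ hΦ

/-- **The Artin avatar of `η^k` is the `k`-th power of the Artin avatar of `η`.**  Let `η` be a
Hecke character, `ψ` a rank-one Artin representation unramified exactly where `η` is and with
`ψ(Φ) = η(ϖ_u)` there, and `ψ_k` the same for `η^k`.  Then `det ψ_k(g) = det ψ(g)^k` for all
`g ∈ Γ_F`: the two continuous homomorphisms `det ψ_k` and `(det ψ)^k` agree at every arithmetic
Frobenius above every place off the finite set where `ψ` or `ψ_k` ramifies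
(`(η^k)(ϖ_u) = η(ϖ_u)^k`), hence everywhere by Frobenius density
(`absoluteGaloisGroup.monoidHom_eq_of_frobenius'`; Serre 1968, Ch. I §2.2, Cor. 2 (a)).
[cite: SerreAbelianLadic1968, Ch. I §2.2, Cor. 2] -/
theorem FramedArtinRep.det_eq_pow_of_avatar (η : HeckeCharacter F) {ψ : FramedArtinRep F 1}
    (hψ : ∀ v : HeightOneSpectrum (𝓞 F), ψ.IsUnramifiedAt v ↔ η.IsUnramifiedAt v)
    (hψF : ∀ v : HeightOneSpectrum (𝓞 F), η.IsUnramifiedAt v →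
      ψ.HasFrobCharpolyAt v (X - C (η.valueAtUniformizer v)))
    {k : ℕ} {ψk : FramedArtinRep F 1}
    (hψk : ∀ v : HeightOneSpectrum (𝓞 F), ψk.IsUnramifiedAt v ↔ (η ^ k).IsUnramifiedAt v)
    (hψkF : ∀ v : HeightOneSpectrum (𝓞 F), (η ^ k).IsUnramifiedAt v →
      ψk.HasFrobCharpolyAt v (X - C ((η ^ k).valueAtUniformizer v)))
    (g : absoluteGaloisGroup F) :
    GaloisRepresentations.FramedRep.det ψk g = GaloisRepresentations.FramedRep.det ψ g ^ k := by
  have hS : ({u : HeightOneSpectrum (𝓞 F) | ¬ ψ.IsUnramifiedAt u} ∪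
      {u | ¬ ψk.IsUnramifiedAt u}).Finite :=
    (Filter.eventually_cofinite.mp ψ.eventually_isUnramifiedAt).union
      (Filter.eventually_cofinite.mp ψk.eventually_isUnramifiedAt)
  have heq : (GaloisRepresentations.FramedRep.det ψk).toMonoidHom =
      (powMonoidHom k).comp (GaloisRepresentations.FramedRep.det ψ).toMonoidHom := by
    refine GaloisRepresentations.absoluteGaloisGroup.monoidHom_eq_of_frobenius'
      (f := (Units.val : ℂˣ → ℂ)) (fun a b h => Units.ext h) hS
      (Units.continuous_val.comp (GaloisRepresentations.FramedRep.det ψk).continuous)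
      ((continuous_pow k).comp
        (Units.continuous_val.comp (GaloisRepresentations.FramedRep.det ψ).continuous))
      fun u hu 𝔓 h𝔓 Φ hΦ => ?_
    simp only [Set.mem_union, Set.mem_setOf_eq, not_or, not_not] at hu
    have h1 : ((GaloisRepresentations.FramedRep.det ψ Φ : ℂˣ) : ℂ) = η.valueAtUniformizer u :=
      FramedArtinRep.det_apply_eq_of_hasFrobCharpolyAt ψ (hψF u ((hψ u).mp hu.1)) h𝔓 hΦ
    have h2 : ((GaloisRepresentations.FramedRep.det ψk Φ : ℂˣ) : ℂ) =
        η.valueAtUniformizer u ^ k := by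
      rw [← valueAtUniformizer_pow']
      exact FramedArtinRep.det_apply_eq_of_hasFrobCharpolyAt ψk (hψkF u ((hψk u).mp hu.2)) h𝔓 hΦ
    apply Units.ext
    show ((GaloisRepresentations.FramedRep.det ψk Φ : ℂˣ) : ℂ) =
      (((GaloisRepresentations.FramedRep.det ψ Φ) ^ k : ℂˣ) : ℂ)
    rw [h2, Units.val_pow_eq_pow_val, h1]
  exact DFunLike.congr_fun heq g

/-- **The auxiliary characters of Jacquet–Langlands' Lemma 12.5, Galois form from idelic form.**
Let `η` be a Hecke character of `F` of finite order, unramified at `v` with `η(ϖ_v) = 1`, such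
that `η^k` is ramified at every `w ∈ S` for all `0 < k ≤ N`.  Then `χ := det ψ_η : Γ_F → ℂˣ`
(`ψ_η` the rank-one Artin representation of `η`,
`HeckeCharacter.exists_framedArtinRep_of_isFiniteOrder` — Tate, Cassels–Fröhlich VII §5.1 with
Neukirch VI (6.6), VII (10.6)) is trivial on the inertia
groups and on the Frobenius elements above `v`, and every inertia group above every `w ∈ S`
contains `g` with `χ(g)^k ≠ 1` for `0 < k ≤ N` (the image `χ(I_𝔓)` is finite cyclic; if its
generator `χ(g₀)` satisfied `χ(g₀)^k = 1` then `χ^k = det ψ_{η^k}` (`det_eq_pow_of_avatar`) would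
kill every inertia group above `w`, making `ψ_{η^k}`, hence `η^k`, unramified at `w`).  See the
module docstring. [cite: JacquetLanglands1970, Lemma 12.5 and proof of Thm. 12.2, p. 210]
[cite: CasselsFrohlichANT1967, Ch. VII §5.1 Main Theorem] -/
theorem exists_galoisCharacter_of_heckeCharacter (v : HeightOneSpectrum (𝓞 F))
    (S : Finset (HeightOneSpectrum (𝓞 F))) (N : ℕ) (η : HeckeCharacter F) (hfin : η.IsFiniteOrder)
    (hunr : η.IsUnramifiedAt v) (hval : η.valueAtUniformizer v = 1)
    (hram : ∀ w ∈ S, ∀ k : ℕ, 0 < k → k ≤ N → ¬ (η ^ k).IsUnramifiedAt w) :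
    ∃ χ : absoluteGaloisGroup F →ₜ* ℂˣ,
      (∀ 𝔓 ∈ v.primesAbove, ∀ g ∈ 𝔓.inertia (absoluteGaloisGroup F), χ g = 1) ∧
      (∀ 𝔓 ∈ v.primesAbove, ∀ g : absoluteGaloisGroup F,
        IsArithFrobAt (𝓞 F) g 𝔓 → χ g = 1) ∧
      (∀ w ∈ S, ∀ 𝔓 ∈ w.primesAbove, ∃ g ∈ 𝔓.inertia (absoluteGaloisGroup F),
        ∀ k : ℕ, 0 < k → k ≤ N → χ g ^ k ≠ 1) := by
  obtain ⟨ψ, hψ, hψF⟩ := η.exists_framedArtinRep_of_isFiniteOrder hfin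
  refine ⟨GaloisRepresentations.FramedRep.det ψ, fun 𝔓 h𝔓 g hg => ?_, fun 𝔓 h𝔓 g hg => ?_,
    fun w hw 𝔓 h𝔓 => ?_⟩
  · rw [GaloisRepresentations.FramedRep.det_apply, ((hψ v).mpr hunr) 𝔓 h𝔓 g hg, map_one]
  · apply Units.ext
    rw [Units.val_one]
    have h := hψF v hunr
    rw [hval] at h
    exact FramedArtinRep.det_apply_eq_of_hasFrobCharpolyAt ψ h h𝔓 hg
  · -- the image of `I_𝔓` under `det ψ` is a finite, hence cyclic, subgroup of `ℂˣ`
    set χ := GaloisRepresentations.FramedRep.det ψ with hχ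
    set H : Subgroup ℂˣ := (𝔓.inertia (absoluteGaloisGroup F)).map χ.toMonoidHom with hH
    haveI : Finite H := by
      haveI : Finite ψ.toMonoidHom.range := finite_range_toMonoidHom ψ
      have hr : (Set.range χ).Finite := by
        have h1 : Set.range χ = Matrix.GeneralLinearGroup.det '' Set.range ψ := by
          rw [← Set.range_comp]
          rfl
        rw [h1]
        refine Set.Finite.image _ ?_
        have : (Set.range ψ) = (ψ.toMonoidHom.range : Set (GL (Fin 1) ℂ)) := by
          rw [MonoidHom.coe_range]; rfl
        rw [this]
        exact Set.toFinite _
      refine Set.Finite.to_subtype (hr.subset ?_)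
      rintro x ⟨g, -, rfl⟩
      exact ⟨g, rfl⟩
    obtain ⟨⟨h₀, hh₀⟩, hgen⟩ := IsCyclic.exists_generator (α := H)
    obtain ⟨g₀, hg₀, hg₀h⟩ := Subgroup.mem_map.mp hh₀
    refine ⟨g₀, hg₀, fun k hk0 hkN hk1 => hram w hw k hk0 hkN ?_⟩
    -- every element of `I_𝔓` has `χ`-value a power of `χ g₀`, hence killed by `k`
    have hkill : ∀ g ∈ 𝔓.inertia (absoluteGaloisGroup F), χ g ^ k = 1 := by
      intro g hg
      have hmem : χ.toMonoidHom g ∈ H := Subgroup.mem_map.mpr ⟨g, hg, rfl⟩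
      obtain ⟨m, hm⟩ := Subgroup.mem_zpowers_iff.mp (hgen ⟨_, hmem⟩)
      have hm' : h₀ ^ m = χ g := by
        have := congrArg Subtype.val hm
        simpa using this
      rw [← hm', ← hg₀h, ← zpow_natCast, ← zpow_mul, mul_comm, zpow_mul, zpow_natCast]
      show (χ g₀ ^ k) ^ m = 1
      rw [hk1, one_zpow]
    -- the same at every prime above `w`, by conjugation
    have hkill' : ∀ 𝔓' ∈ w.primesAbove, ∀ g ∈ 𝔓'.inertia (absoluteGaloisGroup F), χ g ^ k = 1 := by
      intro 𝔓' h𝔓' g hg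
      obtain ⟨τ, rfl⟩ := HeightOneSpectrum.exists_smul_eq_of_mem_primesAbove_holds h𝔓 h𝔓'
      have h := hkill _ (conj_mem_inertia_of_mem_inertia_smul' hg)
      rwa [map_mul, map_mul, map_inv, mul_right_comm, inv_mul_cancel, one_mul] at h
    -- hence the avatar of `η ^ k` is unramified at `w`, and so is `η ^ k`
    obtain ⟨ψk, hψk, hψkF⟩ := (η ^ k).exists_framedArtinRep_of_isFiniteOrder (hfin.pow)
    refine (hψk w).mp fun 𝔓' h𝔓' g hg => apply_eq_one_of_det_eq_one' ψk ?_
    rw [FramedArtinRep.det_eq_pow_of_avatar η hψ hψF hψk hψkF g]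
    exact hkill' 𝔓' h𝔓' g hg

/-- **Gelbart's Prop. 4.1 — both unramified shadows — from Jacquet–Langlands' Lemma 12.5
(idelic, order form) and the twisted Hecke theory of `GL(2)`.**  Hypotheses (displayed inline):
`Hη` — for a finite place `v`, a finite set `S ∌ v` of finite places and `N` there is a
finite-order Hecke character `η` of `F`, unramified at `v` with `η(ϖ_v) = 1`, with `η^k` ramified
at every `w ∈ S` for `0 < k ≤ N` (Jacquet–Langlands 1970, Lemma 12.5; class field theory with
Chevalley 1951, Thm. 1 — see the module docstring); `HT` — as in
`frobSatakeCompatibleAt_of_isPiOfArtinRep_both_of_heckeTheory` (Jacquet–Langlands 1970, Thm. 11.1,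
Cor. 11.2, Thm. 2.18, Props. 3.5, 3.6, 3.8; Gelbart 1997, Thm. 3.2, Example 3.2.3).  Conclusion:
`frobSatakeCompatibleAt_of_isPiOfArtinRep` and
`frobSatakeCompatibleAt_of_isPiOfArtinRep_of_isUnramifiedAt`.  Proof:
`exists_galoisCharacter_of_heckeCharacter` turns `Hη` into the hypothesis `Hχ` of
`frobSatakeCompatibleAt_of_isPiOfArtinRep_both_of_heckeTheory`.
[cite: JacquetLanglands1970, Lemma 12.5, Thm. 11.1, proof of Thm. 12.2 pp. 209–211]
[cite: Gelbart1997, Prop. 4.1] -/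
theorem frobSatakeCompatibleAt_of_isPiOfArtinRep_both_of_heckeCharacters
    (Hη : ∀ {F : Type} [Field F] [NumberField F] (v : HeightOneSpectrum (𝓞 F))
      (S : Finset (HeightOneSpectrum (𝓞 F))), v ∉ S → ∀ N : ℕ,
      ∃ η : HeckeCharacter F, η.IsFiniteOrder ∧ η.IsUnramifiedAt v ∧
        η.valueAtUniformizer v = 1 ∧
        ∀ w ∈ S, ∀ k : ℕ, 0 < k → k ≤ N → ¬ (η ^ k).IsUnramifiedAt w)
    (HT : ∀ {F : Type} [Field F] [NumberField F] (hcpt : isCompact_glFiniteIntegralLevel 2 F)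
      (π : CuspidalAutomorphicRepData 2 F hcpt),
      ∃ Nπ : HeightOneSpectrum (𝓞 F) → ℕ, ∀ χ : absoluteGaloisGroup F →ₜ* ℂˣ,
      ∃ (P P' : HeightOneSpectrum (𝓞 F) → ℂ[X]) (Λ Λ' Γ Γ' ε : ℂ → ℂ) (c : ℝ),
        (∀ u, (P u).eval 0 = 1 ∧ (P u).natDegree ≤ 2) ∧
        (∀ u, (P' u).eval 0 = 1 ∧ (P' u).natDegree ≤ 2) ∧
        Meromorphic Λ ∧ Meromorphic Λ' ∧ Differentiable ℂ Γ ∧ Differentiable ℂ Γ' ∧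
        (∃ Y : Set ℝ, Y.Finite ∧ ∀ s, Γ s = 0 → s.im ∈ Y) ∧
        (∃ Y : Set ℝ, Y.Finite ∧ ∀ s, Γ' s = 0 → s.im ∈ Y) ∧
        Continuous ε ∧ (∀ s, ε s ≠ 0) ∧ 1 ≤ c ∧
        (∀ s : ℂ, c < s.re →
          (Multipliable fun u : HeightOneSpectrum (𝓞 F) =>
              ((P u).eval ((u.residueCard : ℂ) ^ (-s)))⁻¹) ∧
            (∀ u, (P u).eval ((u.residueCard : ℂ) ^ (-s)) ≠ 0) ∧
            Λ s * Γ s =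
              ∏' u : HeightOneSpectrum (𝓞 F), ((P u).eval ((u.residueCard : ℂ) ^ (-s)))⁻¹) ∧
        (∀ s : ℂ, c < s.re →
          (Multipliable fun u : HeightOneSpectrum (𝓞 F) =>
              ((P' u).eval ((u.residueCard : ℂ) ^ (-s)))⁻¹) ∧
            (∀ u, (P' u).eval ((u.residueCard : ℂ) ^ (-s)) ≠ 0) ∧
            Λ' s * Γ' s =
              ∏' u : HeightOneSpectrum (𝓞 F), ((P' u).eval ((u.residueCard : ℂ) ^ (-s)))⁻¹) ∧
        (∀ s, Λ s = ε s * Λ' (1 - s)) ∧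
        (∀ (u : HeightOneSpectrum (𝓞 F)) (α : Multiset ℂ), π.1.HasSatakeParamAt u α →
          (∀ 𝔓 ∈ u.primesAbove, ∀ g ∈ 𝔓.inertia (absoluteGaloisGroup F), χ g = 1) →
          ∀ 𝔓 ∈ u.primesAbove, ∀ g : absoluteGaloisGroup F, IsArithFrobAt (𝓞 F) g 𝔓 →
            P u = eulerPolynomial (α.map fun a => a * (χ g : ℂ)) ∧
              P' u = eulerPolynomial (α.map fun a => a⁻¹ * (χ g : ℂ)⁻¹)) ∧
        (∀ (u : HeightOneSpectrum (𝓞 F)) (α : Multiset ℂ), π.1.HasSatakeParamAt u α →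
          (∃ 𝔓 ∈ u.primesAbove, ∃ g ∈ 𝔓.inertia (absoluteGaloisGroup F), χ g ≠ 1) →
            P u = 1 ∧ P' u = 1) ∧
        (∀ u : HeightOneSpectrum (𝓞 F),
          (∀ 𝔓 ∈ u.primesAbove, ∃ g ∈ 𝔓.inertia (absoluteGaloisGroup F),
            ∀ k : ℕ, 0 < k → k ≤ Nπ u → χ g ^ k ≠ 1) → P u = 1 ∧ P' u = 1) ∧
        (∀ u : HeightOneSpectrum (𝓞 F),
          (∀ 𝔓 ∈ u.primesAbove, ∀ g ∈ 𝔓.inertia (absoluteGaloisGroup F), χ g = 1) →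
          (∀ 𝔓 ∈ u.primesAbove, ∀ g : absoluteGaloisGroup F,
            IsArithFrobAt (𝓞 F) g 𝔓 → χ g = 1) →
          (P u).natDegree = 2 →
            ∃ B : Multiset ℂ, (0 : ℂ) ∉ B ∧ P u = eulerPolynomial B ∧
              π.1.HasSatakeParamAt u B)) :
    frobSatakeCompatibleAt_of_isPiOfArtinRep ∧
      frobSatakeCompatibleAt_of_isPiOfArtinRep_of_isUnramifiedAt :=
  frobSatakeCompatibleAt_of_isPiOfArtinRep_both_of_heckeTheory
    (fun {F} _ _ v S hvS N => by
      obtain ⟨η, hfin, hunr, hval, hram⟩ := Hη v S hvS N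
      exact exists_galoisCharacter_of_heckeCharacter v S N η hfin hunr hval hram)
    HT

end AuxiliaryCharacters

end Literature.NumberTheory.Automorphic

end
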